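import Summits.ABC.StewartYu.PadicG3TwoLevelZeroSat
import Summits.ABC.StewartYu.PadicG3TwoLevelZeroAllSat
import Summits.ABC.StewartYu.PadicG3TwoThirdStepSat
import Summits.ABC.StewartYu.PadicG3TwoEndSat
import HarnessLib

/-!
# Cell abc-stewartyu, WP-L.P(2) (crux r4 `PadicCoreTwoRat`, stmt-ABC-20504), ASSEMBLY: the 𝔑-THREADED `2`-adic frame from the
# record's numbers — `FrameNumericsTwoRASat ⇒ levels ⇒ FrameOutputReal` at `ξ = (α²)^{1/N}`, per set-up `S`, datum `F`

`Summits/ABC/StewartYu/PadicG3TwoFrameSat.lean` — cell `abc-stewartyu` (HOME `run/shared/lean/pub/abc-stewartyu/`), route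
`YuMatveevShapeRat`, seat p3 (g9, WP-L.P(2) lead; design memo HOME/p3/memo-11 §2 rows «levels» / «assembly»).  One `Prop`-structure
(the record's obligation list) and theorems; no named fact.  Twin of p5's `PadicG3TwoLevelZeroAll.FrameNumericsTwoRA /
levels_of_numericsRA / frameOutputTwo_of_mainTwoA` on the Sat layers:

* `FrameNumericsTwoRASat σ F Bv Bv₀ Ucol H L₀ B` — the record's complete obligation list for ONE set-up: the pre-family
  `B ⊆ famBox L₀ (Dbox 0) (Dθ 0)` with virtual box `Bv₀ ≤ Bv 0` (the assembler takes `B = famBoxC L₀ side C`), Siegel count and size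
  (virtual `Dm`), Fel'dman weight lines, coordinate AND virtual box slots (`2·Bv₀/3^{I+1} ≤ Bv (I+1)`), the basis slot
  `Σₖ|U k j| ≤ Ucolⱼ`, `KFinalTwoAllSat 0`, `KFinalTwoSat I` (`1 ≤ I ≤ I*`), `ThirdFinalTwoRSat I` (`I < I*`);
* **`levels_of_numericsRASat`** — Siegel + all-nodes chain at `0` + chains + third steps for the shape
  `ShSat F Bv (ShFeldSat σ F Bv₀ I* H L₀)` (given `‖Λ₀‖ ≤ 2^{−(m+3)}` and the `3`-Kummer condition on the generators);
* `frameOutputReal_mono`;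
* **`frameOutputReal_of_numericsRASat`** — with the END ranges `(d+2)X ≤ Nfin I*`, `(d+2)S₀ < Tfin I*`, the crux's `b` with
  `ball ᵥ* U = N·b`, `det U ≠ 0`: `FrameOutputReal (d+1) ξ b j₀ D₀' S₀ X D'` for any `D₀' ≥ D₀`, `D' ≥ Bv I*`, at
  `ξⱼ = rpowUnit αoⱼ (1/N)`.

WHAT THIS IS NOT: no set-up construction from the crux datum (sequel `PadicG3TwoFrameSatData`: `SatFrameKit.exists_satFrame_two`
+ pivot permutation + `TwoSetup.ofData`), no numbers (records seat, `parTwoN`); no crux moves (A1.L not moved).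

References: K. Yu, Acta Math. 211 (2013), §§3–6; Yu. V. Nesterenko, LNM 1819 (2003), §§3–5; HOME/p3/memo-11 §2.
-/

noncomputable section

open Finset Polynomial
open scoped Matrix
open Literature.NumberTheory.Transcendental
open Literature.NumberTheory.Transcendental (FeldmanDelta.den)
open Literature.NumberTheory.Transcendental.FeldmanDelta
open Literature.NumberTheory.Transcendental.CW77.Setup (Tau tauNorm)
open Literature.NumberTheory.Transcendental.PadicCW77 (condExp)

namespace Summit.ABC.StewartYu

/-- **`FrameOutputReal` is monotone in the degree bounds.** [cite: Nesterenko2003, §5.1 (5.1); shape only] -/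
theorem GenThreeFrameSpecTwoRat.frameOutputReal_mono {n : ℕ} {ξ : Fin n → ℂˣ} {b : Fin n → ℤ} {j₀ : Fin n}
    {D₀ D₀' S₀ X : ℕ} {D D' : Fin n → ℕ} (hD₀ : D₀ ≤ D₀') (hD : ∀ j, D j ≤ D' j)
    (h : GenThreeFrameSpecTwoRat.FrameOutputReal n ξ b j₀ D₀ S₀ X D) :
    GenThreeFrameSpecTwoRat.FrameOutputReal n ξ b j₀ D₀' S₀ X D' := by
  obtain ⟨I, q, i₀, ha, hκ, hi₀, hq, hL⟩ := h
  refine ⟨I, q, i₀, fun i hi => (ha i hi).trans hD₀, fun i hi j => (hκ i hi j).trans ?_, hi₀, hq, hL⟩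
  exact_mod_cast hD j

namespace TwoSetup

open Summit.ABC.StewartYu.FeldmanBasis Summit.ABC.StewartYu.G3Boxes

variable {S : TwoSetup} (σ : S.G3TwoSched) (F : S.SatData) (Bv : ℕ → Fin (S.d + 1) → ℕ)
  (Bv₀ : Fin (S.d + 1) → ℕ) (Ucol : Fin (S.d + 1) → ℕ)

/-! ### The record's obligation list (Sat) -/

/-- **THE RECORD'S COMPLETE OBLIGATION LIST FOR THE 𝔑-THREADED `2`-ADIC FRAME** (one set-up `S`, saturation datum `F`, virtual
schedule `Bv`, level-`0` virtual box `Bv₀`, basis slot `Ucol`, Fel'dman block `H`, `Y₀`-degree `L₀`, pre-family `B`).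
[cite: Yu2013, §3.1 and (5.22); shape only] -/
structure FrameNumericsTwoRASat (H L₀ : ℕ) (B : Finset (ℕ × ((Fin S.d → ℤ) × ℤ))) : Prop where
  /-- the Fel'dman block is nonempty -/
  one_le_H : 1 ≤ H
  /-- at least one order at level `0` -/
  T0_pos : 1 ≤ σ.T0 0
  /-- the pre-family lies in the level-`0` coordinate box -/
  sub : B ⊆ famBox L₀ (σ.Dbox 0) (σ.Dθ 0)
  /-- the pre-family lies in the level-`0` virtual box -/
  vbox : ∀ i ∈ B, ∀ j, |((Fin.snoc i.2.1 i.2.2 : Fin (S.d + 1) → ℤ) ᵥ* F.U) j| ≤ (Bv₀ j : ℤ)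
  /-- the virtual schedule at level `0` -/
  Bv0_le : ∀ j, Bv₀ j ≤ Bv 0 j
  /-- the basis slot (α-coordinates of the saturated basis) -/
  Ucol_ge : ∀ j, ∑ k, |F.U k j| ≤ (Ucol j : ℤ)
  /-- Siegel's count on the slab class -/
  count : 2 * 2 ^ σ.m * (eqSet S.d (σ.N0 0) (σ.T0 0)).card ≤ B.card
  /-- the family-size slot at level `0` -/
  cardB0 : B.card ≤ σ.cardB 0
  /-- the `Y₀`-degree slot -/
  L_le : L₀ ≤ σ.D₀
  /-- the directional slot at level `0` -/
  Xb0 : ∀ i ∈ B, ∀ j, |S.dirScalar i.2.1 i.2.2 j| ≤ σ.Xb 0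
  /-- the `2`-adic weight line at level `0` (radius `4·2^m`) -/
  Bw0 : ∀ ℓ, ℓ ≤ L₀ → ‖((den ℓ H : ℚ_[2]))⁻¹‖ * (4 * (2 : ℝ) ^ σ.m) ^ ℓ ≤ σ.Bw 0
  /-- the `Y₀`-weight denominators are `ν(H)^t` at every level -/
  den₀_eq : ∀ (I : ℕ) (x : ℤ) (τ : Tau S.d), σ.den₀ I x τ = Nat.lcmUpto H ^ τ.1
  /-- Fel'dman's Hasse sizes at the points `3^{I*−I}x`, every level `I ≤ I*` -/
  M₀_ge : ∀ I, I ≤ σ.Istar → ∀ (x : ℤ) (τ : Tau S.d), ∀ ℓ, ℓ ≤ L₀ →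
    (3 : ℝ) ^ ((σ.Istar - I) * τ.1) * ((Nat.lcmUpto H : ℝ) ^ τ.1 *
      (Real.exp (H / Real.exp 1) * (Real.exp 1 * (1 + (3 : ℝ) ^ (σ.Istar - I) * |(x : ℝ)| / H)) ^ ℓ)) ≤
      σ.M₀ I x τ
  /-- the level-`0` Siegel size `Amax` (virtual clearing) and the coefficient slot `P` -/
  level0_size : ∃ (M₀E : ℤ) (Amax : ℝ), (∀ e ∈ eqSet S.d (σ.N0 0) (σ.T0 0), σ.M₀ 0 e.1 e.2 ≤ M₀E) ∧
    1 ≤ Amax ∧ (∀ e ∈ eqSet S.d (σ.N0 0) (σ.T0 0), (M₀E : ℝ) * (σ.Xb 0 : ℝ) ^ (∑ j, e.2.2 j) *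
      ((F.Dm (Bv 0) e.1 : ℝ)) ^ 2 ≤ Amax) ∧
    ⌈(B.card : ℝ) * Amax⌉ ≤ σ.P
  /-- the shrinking coordinate box slots -/
  box : ∀ I, I < σ.Istar → (∀ j, 2 * (σ.Dbox 0 j : ℤ) / 3 ^ (I + 1) ≤ (σ.Dbox (I + 1) j : ℤ)) ∧
    2 * (σ.Dθ 0 : ℤ) / 3 ^ (I + 1) ≤ (σ.Dθ (I + 1) : ℤ)
  /-- the shrinking virtual box slots -/
  vbox_succ : ∀ I, I < σ.Istar → ∀ j, 2 * (Bv₀ j : ℤ) / 3 ^ (I + 1) ≤ (Bv (I + 1) j : ℤ)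
  /-- the level-`0` inner chain, all nodes -/
  kfinal0 : KFinalTwoAllSat σ F Bv 0
  /-- the inner-chain numerics of the levels `1 ≤ I ≤ I*` -/
  kfinal : ∀ I, 1 ≤ I → I ≤ σ.Istar → KFinalTwoSat σ F Bv I
  /-- the third-step numerics of every level below the last -/
  third : ∀ I, I < σ.Istar → ThirdFinalTwoRSat σ F Bv Ucol I

/-! ### The levels from the numbers -/

/-- **THE LEVELS OF THE 𝔑-THREADED FRAME FROM THE NUMBERS**: Siegel, the all-nodes chain at level `0`, the chains of levels
`1 ≤ I ≤ I*` and the third steps, for the shape `ShSat F Bv (ShFeldSat σ F Bv₀ I* H L₀)`.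
[cite: Yu2013, §5 (5.19)–(5.22); shape only] -/
theorem levels_of_numericsRASat {H L₀ : ℕ} {B : Finset (ℕ × ((Fin S.d → ℤ) × ℤ))}
    (hnum : FrameNumericsTwoRASat σ F Bv Bv₀ Ucol H L₀ B)
    (hΛ : ‖S.Λ₀‖ ≤ ((2 : ℝ) ^ (σ.m + 3))⁻¹)
    (hK : ∀ κ : Fin (S.d + 1) → ℕ, (∃ j, ¬ 3 ∣ κ j) → ∀ γ : ℚ, ∏ j, S.toQ.all j ^ κ j ≠ γ ^ 3) :
    SiegelTwo σ (ShSat F Bv (ShFeldSat σ F Bv₀ σ.Istar H L₀)) ∧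
      KChainTwoAll σ (ShSat F Bv (ShFeldSat σ F Bv₀ σ.Istar H L₀)) 0 ∧
      (∀ I, 1 ≤ I → I ≤ σ.Istar → KChainTwo σ (ShSat F Bv (ShFeldSat σ F Bv₀ σ.Istar H L₀)) I) ∧
      (∀ I, I < σ.Istar → ThirdStepTwo σ (ShSat F Bv (ShFeldSat σ F Bv₀ σ.Istar H L₀)) I) := by
  obtain ⟨M₀E, Amax, hM₀E, hAmax, hA, hP⟩ := hnum.level0_size
  refine ⟨?_, kchainTwoAll_of_kfinalAllSat σ F Bv _ hnum.kfinal0,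
    fun I h1 hI => kchainTwo_of_kfinalSat σ F Bv _ (hnum.kfinal I h1 hI), fun I hI => ?_⟩
  · refine siegelTwo_feldSat σ F Bv Bv₀ H L₀ hnum.one_le_H B hnum.sub hnum.vbox hnum.Bv0_le hΛ hnum.T0_pos
      hnum.count hnum.cardB0 hnum.L_le hnum.Xb0 hnum.Bw0 (hnum.den₀_eq 0) ?_ hM₀E hAmax hA hP
    intro x τ ℓ hℓ
    have h := hnum.M₀_ge 0 (Nat.zero_le _) x τ ℓ hℓ
    simpa only [Nat.sub_zero] using h
  · exact thirdStepTwo_ofRSat σ F Bv Ucol _ (hnum.third I hI)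
      (basisStepTwoR_feldSat σ F Bv₀ Bv hnum.one_le_H hI (hnum.den₀_eq (I + 1)) (hnum.M₀_ge (I + 1) hI)
        (hnum.box I hI).1 (hnum.box I hI).2 (hnum.vbox_succ I hI)) hnum.Ucol_ge hK

/-! ### The frame output at `ξ = αo^{1/N}` from the numbers -/

/-- **THE OUTPUT OF THE 𝔑-THREADED `2`-ADIC FRAME FROM THE RECORD'S NUMBERS**: under `FrameNumericsTwoRASat`, the negated bound
`‖Λ₀‖ ≤ 2^{−(m+3)}`, the `3`-Kummer condition on the generators, the END ranges and the crux's `b` with `ball ᵥ* U = N·b`,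
`det U ≠ 0`: `FrameOutputReal (d+1) ξ b j₀ D₀' S₀ X D'` at `ξⱼ = rpowUnit αoⱼ (1/N)` for any `D₀' ≥ D₀`, `D' ≥ Bv I*`.
[cite: Yu2013, §5–§6] [cite: Nesterenko2003, §5.1; shape only] -/
theorem frameOutputReal_of_numericsRASat {H L₀ : ℕ} {B : Finset (ℕ × ((Fin S.d → ℤ) × ℤ))}
    (hnum : FrameNumericsTwoRASat σ F Bv Bv₀ Ucol H L₀ B)
    (hΛ : ‖S.Λ₀‖ ≤ ((2 : ℝ) ^ (σ.m + 3))⁻¹)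
    (hK : ∀ κ : Fin (S.d + 1) → ℕ, (∃ j, ¬ 3 ∣ κ j) → ∀ γ : ℚ, ∏ j, S.toQ.all j ^ κ j ≠ γ ^ 3)
    (b : Fin (S.d + 1) → ℤ) (hbU : S.ball ᵥ* F.U = (F.N : ℤ) • b) (hdetU : F.U.det ≠ 0) (j₀ : Fin (S.d + 1))
    {X S₀ : ℕ} (hX : (S.d + 1 + 1) * X ≤ σ.Nfin σ.Istar) (hT : (S.d + 1 + 1) * S₀ < σ.Tfin σ.Istar)
    {D₀' : ℕ} {D' : Fin (S.d + 1) → ℕ} (hD₀ : σ.D₀ ≤ D₀') (hD : ∀ j, Bv σ.Istar j ≤ D' j) :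
    GenThreeFrameSpecTwoRat.FrameOutputReal (S.d + 1)
      (fun j => GenThreeEndReal.rpowUnit (F.αo j : ℝ) (by exact_mod_cast F.hαo j) ((F.N : ℝ)⁻¹))
      b j₀ D₀' S₀ X D' := by
  obtain ⟨hS, hk0, hk, hth⟩ := levels_of_numericsRASat σ F Bv Bv₀ Ucol hnum hΛ hK
  obtain ⟨Λ, hadm, hvan⟩ := mainTwoA σ _ hS hk0 hk hth
  refine GenThreeFrameSpecTwoRat.frameOutputReal_mono hD₀ hD ?_
  refine S.frameOutputReal_of_g3φ_sat F Λ.R Λ.u Λ.uθ Λ.B Λ.p b hbU hdetU j₀ hadm.deg_le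
    (vbox_of_adm σ F Bv _ hadm) (exists_fibre_ne_zero_of_adm σ _ hadm) ?_
  intro x hx τ hτ
  refine hvan x (hx.trans ?_) trivial τ (lt_of_le_of_lt hτ hT)
  exact_mod_cast hX

end TwoSetup

end Summit.ABC.StewartYu

end
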